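import Summits.CriticalPhenomena.PercolationContinuityZ3.Theorems.PercNearOneGluingAdditiveGluingThreeRelaysTd
import HarnessLib

/-! # Crux `PercNearOneGluing.AdditiveGluing` (stmt-CriticalPhenomena-4576): assembly from the three-relay TIE-LOCUS E-FORM,
# and `AdditiveGluing` from the glued-pair exchange (T-d) + the tie instances with at least four relays

Support file (`--supports stmt-CriticalPhenomena-4576`, lead prim-png-lead-4576).  No definitions, no named facts, no sorries.
* `additiveGluing_of_erase_card_le_three_of_threeTieForm` : the landed `additiveGluing_of_erase_card_le_three_of_tieRegionCert`
  with the three-relay tie-locus E-form `μ(o↔A ∖ o↔b) ≤ t` (for distinct relays with `τ₃ ≤ τ₁ ≤ τ₃`, `τ₃ ≤ τ₂`, `1 − t ≤ τ₃`) taken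
  as the hypothesis, so that ANY proof of that E-form (T1-tie certificate, (T-d), Ψ ≥ 0, …) plugs in;
* `additiveGluing_of_threeTieForm_and_four` : E-form(3, tie) → AG-tie(≥ 4) → `AdditiveGluing`;
* `additiveGluing_of_gluedPairExchange_and_four` : (T-d) (`stub_gluedPairExchangeTie_pl`) → AG-tie(≥ 4)
  (`stub_additiveGluingTieFour_pl`) → `AdditiveGluing` — the (T-d) line closed modulo its two registered stubs.
[cite: KozmaNitzan2024, Conjecture 1 (p. 3), Theorem 2 (§3.2), §5.3 (p. 34)]
-/

namespace Summit.CriticalPhenomena.PercolationContinuityZ3.Theorems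

open MeasureTheory Set Literature.Probability.LatticeModels Literature.Probability.Percolation

noncomputable section
open Classical

/-- **`AdditiveGluing` for at most three relays besides the target, from the three-relay tie-locus E-form.**  Pointwise
minimiser-tie reduction; minimum `1` ⇒ union bound; else the tied minimal relays are not `b`; at most two relays ⇒ landed two-relay
theorems; three relays ⇒ the E-form with `a₁ = a'` (tied), `a₂ = y`, `a₃ = a` (minimal).  (Same proof as the landed
`additiveGluing_of_erase_card_le_three_of_tieRegionCert`, with the E-form abstracted.)
[cite: KozmaNitzan2024, Conjecture 1 (p. 3), Theorem 2 (§3.2), §5.3] -/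
theorem additiveGluing_of_erase_card_le_three_of_threeTieForm
    (h3form : ∀ (n : ℕ) (w : Sym2 (Fin n) → unitInterval) (o b a₁ a₂ a₃ : Fin n) (t : ℝ),
      a₁ ≠ a₂ → a₁ ≠ a₃ → a₂ ≠ a₃ →
      1 - t ≤ (prodBernoulli w).real (openConn a₃ b) →
      (prodBernoulli w).real (openConn a₃ b) ≤ (prodBernoulli w).real (openConn a₁ b) →
      (prodBernoulli w).real (openConn a₃ b) ≤ (prodBernoulli w).real (openConn a₂ b) →
      (prodBernoulli w).real (openConn a₁ b) ≤ (prodBernoulli w).real (openConn a₃ b) →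
      (prodBernoulli w).real ((openConn o a₁ ∪ openConn o a₂ ∪ openConn o a₃) \ openConn o b) ≤ t) :
    ∀ (n : ℕ) (w : Sym2 (Fin n) → unitInterval) (A : Finset (Fin n)) (o b : Fin n) (t : ℝ),
      (A.erase b).card ≤ 3 → 0 ≤ t →
      (∀ a ∈ A, 1 - t ≤ (prodBernoulli w).real (openConn a b)) →
      (prodBernoulli w).real (⋃ a ∈ A, openConn o a) - t ≤ (prodBernoulli w).real (openConn o b) := by
  intro n w A o b t hcard ht hrel
  by_cases hsmall : (A.erase b).card ≤ 2
  · -- at most two relays besides `b`: deep seat r2's assembly never uses the certificate there, but its statement takes it;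
    -- we redo the two-relay bookkeeping via the landed `additiveGluing_of_erase_card_le_three_of_regionCert` applied with a
    -- VACUOUS relay triple is not possible, so we call the landed two-relay theorems directly.
    have hm : ∀ s : Set (BondConfig (Fin n)), MeasurableSet s := fun _ => MeasurableSet.of_discrete
    have hU1 : (prodBernoulli w).real (⋃ a ∈ A, (openConn o a : Set (BondConfig (Fin n)))) ≤ 1 := measureReal_le_one
    by_cases hoA : o ∈ A
    · have h := hrel o hoA
      have hoo : (openConn o o : Set (BondConfig (Fin n))) = Set.univ :=
        Set.eq_univ_of_forall fun ω => (SimpleGraph.Reachable.refl o : (openGraph ω).Reachable o o)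
      have : (prodBernoulli w).real (openConn o o : Set (BondConfig (Fin n))) ≤ (prodBernoulli w).real (openConn o b) +
          (prodBernoulli w).real ((openConn o o : Set (BondConfig (Fin n))) \ openConn o b) := by
        have := measureReal_inter_add_sdiff (μ := prodBernoulli w) (s := (openConn o o : Set (BondConfig (Fin n)))) (hm (openConn o b))
        have h2 : (prodBernoulli w).real ((openConn o o : Set (BondConfig (Fin n))) ∩ openConn o b) ≤
            (prodBernoulli w).real (openConn o b : Set (BondConfig (Fin n))) := measureReal_mono Set.inter_subset_right
        linarith
      have h3 := tieRed_sdiff_le_one_sub w o o b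
      rw [hoo, probReal_univ] at this
      rw [hoo] at h3
      linarith
    by_cases hbA : b ∈ A
    · have hA3 : A.card ≤ 3 := by
        have := Finset.card_erase_of_mem hbA; omega
      have hK := stub_goodCardLeThree_k42 n w A o b hbA hoA hA3 t (fun _ => b) (fun _ => hbA) hrel
      have hP : 0 ≤ ∑ W ∈ (Finset.univ : Finset (Finset (Fin n))).filter (fun W => o ∈ W ∧ Disjoint W A),
          (prodBernoulli w).real {ω : BondConfig (Fin n) | openCluster ω o = (W : Set (Fin n))} *
            (prodBernoulli w).real (openConnIn ((W : Set (Fin n))ᶜ) b b)ᶜ :=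
        Finset.sum_nonneg fun W _ => mul_nonneg measureReal_nonneg measureReal_nonneg
      have h1 := measureReal_inter_add_sdiff (μ := prodBernoulli w) (s := ⋃ a ∈ A, openConn o a) (hm (openConn o b))
        (h := measure_ne_top _ _)
      have h2 : (prodBernoulli w).real ((⋃ a ∈ A, openConn o a) ∩ openConn o b) ≤
          (prodBernoulli w).real (openConn o b : Set (BondConfig (Fin n))) := measureReal_mono Set.inter_subset_right
      have h3 : ((⋃ a ∈ A, openConn o a) \ openConn o b : Set (BondConfig (Fin n))) =
          (⋃ a ∈ A, openConn o a) ∩ (openConn o b)ᶜ := Set.sdiff_eq _ _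
      rw [h3] at h1
      linarith
    · have hA2 : A.card ≤ 2 := by rwa [Finset.erase_eq_of_notMem hbA] at hsmall
      exact additiveGluing_of_card_le_two n w A o b t hA2 ht hrel
  -- exactly three relays besides `b`: reduce to the tie locus
  have h3 : (A.erase b).card = 3 := by omega
  refine additiveGluing_pointwise_of_minTie n A o b ?_ w t ht hrel
  intro w' htie' t' ht' hrel'
  obtain ⟨a, ha, a', ha', hne, heq, hmin⟩ := htie'
  have hm : ∀ s : Set (BondConfig (Fin n)), MeasurableSet s := fun _ => MeasurableSet.of_discrete
  -- decomposition `μ(o↔A) ≤ μ(o↔b) + μ(o↔A ∖ o↔b)`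
  have hsplit : (prodBernoulli w').real (⋃ c ∈ A, (openConn o c : Set (BondConfig (Fin n)))) ≤
      (prodBernoulli w').real (openConn o b : Set (BondConfig (Fin n))) +
        (prodBernoulli w').real ((⋃ c ∈ A, (openConn o c : Set (BondConfig (Fin n)))) \ openConn o b) := by
    have h1 := measureReal_inter_add_sdiff (μ := prodBernoulli w') (s := ⋃ c ∈ A, (openConn o c : Set (BondConfig (Fin n))))
      (hm (openConn o b)) (h := measure_ne_top _ _)
    have h2 : (prodBernoulli w').real ((⋃ c ∈ A, (openConn o c : Set (BondConfig (Fin n)))) ∩ openConn o b) ≤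
        (prodBernoulli w').real (openConn o b : Set (BondConfig (Fin n))) := measureReal_mono Set.inter_subset_right
    linarith
  -- if the minimum is `1`, every relay is a.s. joined to `b`: union bound
  by_cases hone : (prodBernoulli w').real (openConn a b) = 1
  · have hnull : (prodBernoulli w').real ((⋃ c ∈ A, (openConn o c : Set (BondConfig (Fin n)))) \ openConn o b) ≤ 0 := by
      have hsub : ((⋃ c ∈ A, (openConn o c : Set (BondConfig (Fin n)))) \ openConn o b) ⊆
          ⋃ c ∈ A, ((openConn o c : Set (BondConfig (Fin n))) \ openConn o b) := by
        intro ω hω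
        simp only [Set.mem_sdiff, Set.mem_iUnion] at hω ⊢
        obtain ⟨⟨c, hc, hoc⟩, hob⟩ := hω
        exact ⟨c, hc, hoc, hob⟩
      refine (measureReal_mono hsub (measure_ne_top _ _)).trans ((measureReal_biUnion_finset_le A _).trans ?_)
      refine Finset.sum_nonpos fun c hc => ?_
      have h1 := tieRed_sdiff_le_one_sub w' o c b
      have h2 := hmin c hc
      have h3 : (prodBernoulli w').real (openConn c b : Set (BondConfig (Fin n))) ≤ 1 := measureReal_le_one
      linarith
    linarith
  -- otherwise the tied minimal relays are not `b`
  have hab : a ≠ b := by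
    rintro rfl
    have : (openConn a a : Set (BondConfig (Fin n))) = Set.univ :=
      Set.eq_univ_of_forall fun ω => (SimpleGraph.Reachable.refl a : (openGraph ω).Reachable a a)
    rw [this, probReal_univ] at hone
    exact hone rfl
  have ha'b : a' ≠ b := by
    rintro rfl
    have : (openConn a' a' : Set (BondConfig (Fin n))) = Set.univ :=
      Set.eq_univ_of_forall fun ω => (SimpleGraph.Reachable.refl a' : (openGraph ω).Reachable a' a')
    rw [this, probReal_univ] at heq
    exact hone heq
  have haS : a ∈ A.erase b := Finset.mem_erase.2 ⟨hab, ha⟩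
  have ha'S : a' ∈ A.erase b := Finset.mem_erase.2 ⟨ha'b, ha'⟩
  -- the third relay `y`
  have hT : ((A.erase b).erase a).erase a' = (((A.erase b).erase a).erase a') := rfl
  have hTcard : (((A.erase b).erase a).erase a').card = 1 := by
    have h1 : ((A.erase b).erase a).card = 2 := by rw [Finset.card_erase_of_mem haS]; omega
    have ha'T : a' ∈ (A.erase b).erase a := Finset.mem_erase.2 ⟨hne.symm, ha'S⟩
    rw [Finset.card_erase_of_mem ha'T]; omega
  obtain ⟨y, hy⟩ := Finset.card_eq_one.1 hTcard
  have hyT : y ∈ ((A.erase b).erase a).erase a' := by rw [hy]; exact Finset.mem_singleton_self y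
  obtain ⟨hya', hyT'⟩ := Finset.mem_erase.1 hyT
  obtain ⟨hya, hyS⟩ := Finset.mem_erase.1 hyT'
  obtain ⟨hyb, hyA⟩ := Finset.mem_erase.1 hyS
  have hcover : ∀ c ∈ A.erase b, c = a ∨ c = a' ∨ c = y := by
    intro c hc
    by_cases hca : c = a
    · exact Or.inl hca
    by_cases hca' : c = a'
    · exact Or.inr (Or.inl hca')
    have : c ∈ ((A.erase b).erase a).erase a' := Finset.mem_erase.2 ⟨hca', Finset.mem_erase.2 ⟨hca, hc⟩⟩
    rw [hy] at this
    exact Or.inr (Or.inr (Finset.mem_singleton.1 this))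
  -- the tie-locus E-form with `a₁ = a'`, `a₂ = y`, `a₃ = a`
  have hE := h3form n w' o b a' y a t' hya'.symm hne.symm hya
    (hrel' a ha) (hmin a' ha') (hmin y hyA) (le_of_eq heq.symm)
  have hsub : ((⋃ c ∈ A, (openConn o c : Set (BondConfig (Fin n)))) \ openConn o b) ⊆
      (openConn o a' ∪ openConn o y ∪ openConn o a) \ openConn o b := by
    intro ω hω
    simp only [Set.mem_sdiff, Set.mem_iUnion] at hω
    obtain ⟨⟨c, hcA, hoc⟩, hob⟩ := hω
    refine ⟨?_, hob⟩
    have hcb : c ≠ b := by rintro rfl; exact hob hoc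
    rcases hcover c (Finset.mem_erase.2 ⟨hcb, hcA⟩) with rfl | rfl | rfl
    · exact Or.inr hoc
    · exact Or.inl (Or.inl hoc)
    · exact Or.inl (Or.inr hoc)
  have hle := measureReal_mono (μ := prodBernoulli w') hsub (measure_ne_top _ _)
  linarith


/-- **`AdditiveGluing` from the three-relay tie-locus E-form and the tie instances with at least four relays.**
[cite: KozmaNitzan2024, §5.3 (p. 34)] -/
theorem additiveGluing_of_threeTieForm_and_four
    (h3form : ∀ (n : ℕ) (w : Sym2 (Fin n) → unitInterval) (o b a₁ a₂ a₃ : Fin n) (t : ℝ),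
      a₁ ≠ a₂ → a₁ ≠ a₃ → a₂ ≠ a₃ →
      1 - t ≤ (prodBernoulli w).real (openConn a₃ b) →
      (prodBernoulli w).real (openConn a₃ b) ≤ (prodBernoulli w).real (openConn a₁ b) →
      (prodBernoulli w).real (openConn a₃ b) ≤ (prodBernoulli w).real (openConn a₂ b) →
      (prodBernoulli w).real (openConn a₁ b) ≤ (prodBernoulli w).real (openConn a₃ b) →
      (prodBernoulli w).real ((openConn o a₁ ∪ openConn o a₂ ∪ openConn o a₃) \ openConn o b) ≤ t)
    (hFour : ∀ (n : ℕ) (w : Sym2 (Fin n) → unitInterval) (A : Finset (Fin n)) (o b : Fin n) (t : ℝ), 4 ≤ (A.erase b).card → (∃ a ∈ A, ∃ a' ∈ A, a ≠ a' ∧ (prodBernoulli w).real (openConn a b) = (prodBernoulli w).real (openConn a' b) ∧ ∀ c ∈ A, (prodBernoulli w).real (openConn a b) ≤ (prodBernoulli w).real (openConn c b)) → 0 ≤ t → (∀ a ∈ A, 1 - t ≤ (prodBernoulli w).real (openConn a b)) → (prodBernoulli w).real (⋃ a ∈ A, openConn o a) - t ≤ (prodBernoulli w).real (openConn o b)) 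:
    Summit.CriticalPhenomena.PercolationContinuityZ3.Theses.PercNearOneGluing.AdditiveGluing := by
  intro n w A o b t ht hrel
  by_cases h3 : (A.erase b).card ≤ 3
  · exact additiveGluing_of_erase_card_le_three_of_threeTieForm h3form n w A o b t h3 ht hrel
  · have h4 : 4 ≤ (A.erase b).card := by omega
    exact additiveGluing_pointwise_of_minTie n A o b (fun w' htie t' ht' hrel' => hFour n w' A o b t' h4 htie ht' hrel') w t ht hrel

/-- **`AdditiveGluing` from the glued-pair exchange (T-d) and the tie instances with at least four relays** — the (T-d) line
closed modulo its two registered stubs `stub_gluedPairExchangeTie_pl`, `stub_additiveGluingTieFour_pl`.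
[cite: KozmaNitzan2024, Theorem 1 (§3.1), §5.3 (p. 34)] -/
theorem additiveGluing_of_gluedPairExchange_and_four
    (hTd : ∀ (n : ℕ) (w : Sym2 (Fin n) → unitInterval) (o b a₁ a₂ a₃ : Fin n), a₁ ≠ a₂ → a₁ ≠ a₃ → a₂ ≠ a₃ → (prodBernoulli w).real (openConn a₃ b) ≤ (prodBernoulli w).real (openConn a₁ b) → (prodBernoulli w).real (openConn a₃ b) ≤ (prodBernoulli w).real (openConn a₂ b) → (prodBernoulli w).real (openConn a₁ b) ≤ (prodBernoulli w).real (openConn a₃ b) → (prodBernoulli w).real (openConn o b) < (prodBernoulli w).real (openConn a₃ b) → (prodBernoulli w).real ((openConn a₁ a₃)ᶜ ∩ (openConn a₂ a₃)ᶜ ∩ (openConn a₁ b ∩ openConn a₂ b)) < (prodBernoulli w).real ((openConn a₁ a₃)ᶜ ∩ (openConn a₂ a₃)ᶜ ∩ openConn a₃ b) → ((prodBernoulli w).real ((openConn a₂ a₁)ᶜ ∩ (openConn a₂ a₃)ᶜ ∩ (openConn o a₁ ∪ openConn o a₃)) + (prodBernoulli w).real ((openConn a₂ a₁)ᶜ ∩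 (openConn a₂ a₃)ᶜ ∩ openConn o a₂)) * (prodBernoulli w).real ((openConn o b)ᶜ ∩ (openConn o a₁ ∩ openConn a₃ b ∪ openConn o a₃ ∩ openConn a₁ b)) ≤ (prodBernoulli w).real ((openConn a₂ a₁)ᶜ ∩ (openConn a₂ a₃)ᶜ ∩ (openConn o a₁ ∪ openConn o a₃)) * ((prodBernoulli w).real (openConn a₁ b ∩ (openConn a₃ b)ᶜ) + (prodBernoulli w).real ((openConn a₁ b)ᶜ ∩ (openConn a₃ b)ᶜ ∩ (openConn o a₁ ∪ openConn o a₂ ∪ openConn o a₃)ᶜ)) + (prodBernoulli w).real ((openConn a₂ a₁)ᶜ ∩ (openConn a₂ a₃)ᶜ ∩ openConn o a₂) * (((prodBernoulli w).real (openConn a₂ b) - (prodBernoulli w).real (openConn a₃ b)) + (prodBernoulli w).real ((openConn a₂ b)ᶜ ∩ (openConn a₂ a₁ ∩ openConn a₃ b ∪ openConn a₂ a₃ ∩ openConn a₁ b)) + (prodBernoulli w).real ((openConn a₂ b)ᶜ ∩ ((openConn a₂ a₁ ∪ openConn a₂ a₃) ∩ (openConn a₁ b ∪ openConn a₃ b))ᶜ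 ∩ (openConn o a₁ ∪ openConn o a₂ ∪ openConn o a₃)ᶜ)))
    (hFour : ∀ (n : ℕ) (w : Sym2 (Fin n) → unitInterval) (A : Finset (Fin n)) (o b : Fin n) (t : ℝ), 4 ≤ (A.erase b).card → (∃ a ∈ A, ∃ a' ∈ A, a ≠ a' ∧ (prodBernoulli w).real (openConn a b) = (prodBernoulli w).real (openConn a' b) ∧ ∀ c ∈ A, (prodBernoulli w).real (openConn a b) ≤ (prodBernoulli w).real (openConn c b)) → 0 ≤ t → (∀ a ∈ A, 1 - t ≤ (prodBernoulli w).real (openConn a b)) → (prodBernoulli w).real (⋃ a ∈ A, openConn o a) - t ≤ (prodBernoulli w).real (openConn o b)) :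
    Summit.CriticalPhenomena.PercolationContinuityZ3.Theses.PercNearOneGluing.AdditiveGluing :=
  additiveGluing_of_threeTieForm_and_four (additiveGluing_threeRelays_of_gluedPairExchange hTd) hFour

end

end Summit.CriticalPhenomena.PercolationContinuityZ3.Theorems
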